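import Summits.CriticalPhenomena.CardyFormulaZ2.Theses.CardyIKTransport
import Summits.CriticalPhenomena.CardyFormulaZ2.Theses.CardyDiluteOrbit
import Summits.CriticalPhenomena.CardyFormulaZ2.Theorems.IKMixedBoxCrossing.Negative.IKMixedBoxCrossingSmallModels
import Summits.CriticalPhenomena.CardyFormulaZ2.Theorems.IKMixedBoxCrossing.Negative.IKMixedBoxCrossingNoFKG
import Summits.CriticalPhenomena.CardyFormulaZ2.Theorems.IKMixedBoxCrossing.Negative.IKMixedBoxCrossingNoBondFKG
import Literature.Probability.LatticeModels.CellGridSaddlePercolationProofs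

/-!
# Line `xor-rectangle-flip` — VOCABULARY + COMPOSITION (defs-only support file) for the crux `IKMixedBoxCrossing`
(crux item stmt-CriticalPhenomena-5911; routes CardyIKTransport r4 = CardyDiluteOrbit r2; statements by the planner
crux-plan seat, round 1, landed unchanged by the line lead prover-line-stmt-CriticalPhenomena-5911-0 (2026-08-16) so that the stub
PROOF files `Theorems/CardyIKTransportIKMixedBoxCrossingXorStub<Name>.lean` (`--supports stmt-CriticalPhenomena-5911`) and the
lead's skeleton share one copy of every object — the five registered stubs `stub_xorFlip`, `stub_condDichotomy`,
`stub_isotropyFloor`, `stub_boundaryRobustFloor`, `stub_gluing` are NOT declared here (they are the sorries of the skeleton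
`Cruxes/IKMixedBoxCrossing/Lines/xor_rectangle_flip.lean`); nothing in this file is asserted: every `def … : Prop` is a statement the
LINE POSITS; idea card `Cruxes/IKMixedBoxCrossing/Ideas/xor-rectangle-flip.md`, triage
TRIAGE-r1-{1,2,3}.md: pass ×3, sharpen "add `t ≤ 1`" — moot here, everything is stated at the crux's
own fugacity `t = √3/2` over the crux's own gauge `μIK`).

THE LINE. The crux is RSW (long-way crossings of `2n × n` and `n × 2n` boxes, uniformly in the
column pattern `S`, the scale and the position) for a planar colouring field WITHOUT positive
association (`Negative.colourField_not_positivelyAssociated`, `Negative.bondField_not_positivelyAssociated`).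
The lever of the card is the one monotonicity-free tool that is EXACT for this gauge: flipping all
colours inside an axis-parallel rectangle `Q` is realised on the bit space by an involution that
toggles the (at most four) corner plaquettes of `Q` in both plaquette coordinates plus fair line
bits, so it has density `≤ (2/√3)⁴ = 16/9` for EVERY `S`, preserves the diagonals, and commutes with
every event that does not read colours inside `Q` (`stub_xorFlip`, S1). With the Hex lemma of the
one-diagonal-per-face triangulation (tree: `cellCrossing_duality_holds`) and the exact colour-flip
symmetry this gives the CONDITIONAL BOX DICHOTOMY (`stub_condDichotomy`, S2): for every `S`, every
box and every event `F` of the EXTERIOR σ-algebra (colours outside the box, diagonals outside the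
box: `exteriorSigma`), `μ F ≤ μ(blackLR ∩ F) + 16/9 · μ(blackTB ∩ F)` and symmetrically — boxes are crossed in at least one
direction with conditional probability `≥ 9/25` under ANY exterior information, uniformly in `S`.
This is the boundary-condition-uniform non-degeneracy that every RSW scheme consumes and that FKG
models get from comparison of boundary conditions. The remaining distance to the crux is cut at its
two genuine joints: (I) the `∀ S` ANISOTROPY layer — squares are crossed BOTH ways with probability
`≥ m` for every column pattern (`stub_isotropyFloor`, S3; duality gives `P(LR) + P(TB) = 1` on squares
for every `S`, so only unbounded effective anisotropy of a columnar mixture can fail it; numerics: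
squares `∈ [0.47, 0.53]` for every tested `S`, kit j012395 Part D); (II-a) BOUNDARY ROBUSTNESS —
exterior conditioning acts on a square by an exact plaid XOR-symmetry composed with `≤ 4n` boundary
plaquette frustrations of fugacity `1/t`, and does not destroy square crossings
(`stub_boundaryRobustFloor`, S4: the card's lever (b) as a theorem); (II-b) FKG-FREE GLUING — from
exterior-uniform square crossings and the conditional dichotomy to long crossings
(`stub_gluing`, S5, the hardest: Beffara–Gayet arXiv:1710.10644 §3, Lemmas 2.17–2.19 "rectangle to
long rectangle" with conditional crossing inputs in place of Harris, is the template; the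
symmetrisation step needs the seam-corrected involution `Ψ_S` of card paired-mirror-exploration for
general `S`). `IKMixedBoxCrossing_of` composes S1–S5 into the crux BY NAME through
`Negative.iff_named` (the crux ↔ its named form over `pH`, `pV`).

DISPROOF USED (Cruxes/IKMixedBoxCrossing/Disproof.lean, cdisprove c1–c2; landed as the three
`Theorems/IKMixedBoxCrossing/Negative/*` files imported above): `iKMixedBoxCrossing_false_without_n_pos`
— honoured: `1 ≤ n` is kept in `IsotropyFloor`, `CondSquareFloor`, `CruxNamed` (for `n = 0` the box
events are empty); `pH_one_zero_zero` / `c_le_quarter` / `not_IKMixedBoxCrossing_with_large_constant`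
— respected: all constants are existential, no stub asks for `c > 1/4`; `colourField_not_positivelyAssociated`,
`bondField_not_positivelyAssociated` — no stub uses positive association of colours or bonds (S2, S4,
S5 are phrased with flip-invariant conditioning, never with increasing events). No stub is an
instance of a landed Negative lemma.
-/

set_option linter.dupNamespace false

open scoped ENNReal
open MeasureTheory
open Literature.Probability.Percolation Literature.Probability.LatticeModels
open Summit.CriticalPhenomena.CardyFormulaZ2.Theorems.IKMixedBoxCrossing.Negative
  (Ω μIK blackSet antiSet edges hEvent vEvent pH pV iff_named)

noncomputable section

namespace Summit.CriticalPhenomena.CardyFormulaZ2.Cruxes.IKMixedBoxCrossing.XorRectangleFlip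

/-! ## Boxes, sides and crossing events of the gauge (general position and size) -/

/-- The cell box `[a, a+W) × [b, b+H)` (empty when `W ≤ 0` or `H ≤ 0`). -/
def box (a b W H : ℤ) : Set (Site 2) := {v | a ≤ v 0 ∧ v 0 < a + W ∧ b ≤ v 1 ∧ v 1 < b + H}

/-- Left column of `box a b W H`. -/
def leftCol (a b _W H : ℤ) : Set (Site 2) := {v | v 0 = a ∧ b ≤ v 1 ∧ v 1 < b + H}

/-- Right column of `box a b W H`. -/
def rightCol (a b W H : ℤ) : Set (Site 2) := {v | v 0 = a + W - 1 ∧ b ≤ v 1 ∧ v 1 < b + H}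

/-- Bottom row of `box a b W H`. -/
def bottomRow (a b W _H : ℤ) : Set (Site 2) := {v | v 1 = b ∧ a ≤ v 0 ∧ v 0 < a + W}

/-- Top row of `box a b W H`. -/
def topRow (a b W H : ℤ) : Set (Site 2) := {v | v 1 = b + H - 1 ∧ a ≤ v 0 ∧ v 0 < a + W}

/-- Left–right open crossing of `box a b W H` (bond-configuration event). -/
def lrCross (a b W H : ℤ) : Set (BondConfig (Site 2)) :=
  openCrossing (box a b W H) (leftCol a b W H) (rightCol a b W H)

/-- Bottom–top open crossing of `box a b W H` (bond-configuration event). -/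
def tbCross (a b W H : ℤ) : Set (BondConfig (Site 2)) :=
  openCrossing (box a b W H) (bottomRow a b W H) (topRow a b W H)

/-- The cell-grid bond encoding of a colour class `B` with anti-diagonal faces `D`: nearest
neighbours inside `B`, the main diagonal of the face at `u` when `u ∉ D`, the anti-diagonal of the
face at `u + (0,-1)` when that face is in `D` (verbatim the shape of `Negative.edges`). -/
def cellEdges (B D : Set (Site 2)) : BondConfig (Site 2) :=
  {e | ∃ u v, e = s(u, v) ∧ u ∈ B ∧ v ∈ B ∧ (v = u + ![1, 0] ∨ v = u + ![0, 1] ∨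
    (v = u + ![1, 1] ∧ u ∉ D) ∨ (v = u + ![1, -1] ∧ (u + ![0, -1]) ∈ D))}

/-- The crux's bond field is the cell encoding of (black cells, anti-diagonal faces). -/
theorem edges_eq_cellEdges (S : Set ℤ) (ω : Ω) :
    edges S ω = cellEdges (blackSet S ω) (antiSet S ω) := rfl

/-- WHITE bonds: the same encoding for the complementary colour class and the SAME diagonals. -/
def whiteEdges (S : Set ℤ) (ω : Ω) : BondConfig (Site 2) := cellEdges (blackSet S ω)ᶜ (antiSet S ω)

/-- Black left–right crossing event of `box a b W H`. -/
def bLR (S : Set ℤ) (a b W H : ℤ) : Set Ω := {ω | edges S ω ∈ lrCross a b W H}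

/-- Black bottom–top crossing event of `box a b W H`. -/
def bTB (S : Set ℤ) (a b W H : ℤ) : Set Ω := {ω | edges S ω ∈ tbCross a b W H}

/-- White left–right crossing event of `box a b W H`. -/
def wLR (S : Set ℤ) (a b W H : ℤ) : Set Ω := {ω | whiteEdges S ω ∈ lrCross a b W H}

/-- White bottom–top crossing event of `box a b W H`. -/
def wTB (S : Set ℤ) (a b W H : ℤ) : Set Ω := {ω | whiteEdges S ω ∈ tbCross a b W H}

/-- The crux's `2n × n` event is `bLR` of the `2n × n` box (definitional). -/
theorem hEvent_eq_bLR (S : Set ℤ) (n : ℕ) (a b : ℤ) : hEvent S n a b = bLR S a b (2 * n) n := rfl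

/-- The crux's `n × 2n` event is `bTB` of the `n × 2n` box (definitional). -/
theorem vEvent_eq_bTB (S : Set ℤ) (n : ℕ) (a b : ℤ) : vEvent S n a b = bTB S a b n (2 * n) := rfl

/-! ## Rectangle flips (the lever) -/

/-- `Q` is an axis-parallel rectangle of cells (possibly empty). -/
def IsCellRect (Q : Set (Site 2)) : Prop := ∃ a b W H : ℤ, Q = box a b W H

/-- `Φ` is an XOR FLIP OF THE RECTANGLE `Q` for the pattern `S`: a measurable involution of the bit
space that flips the colour of exactly the cells of `Q`, keeps every diagonal, and expands
`μIK`-mass by at most `16/9 = (2/√3)⁴` (four corner plaquettes, each of density `≤ 1/t`). The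
density clause is stated for ALL sets: for a measurable `Φ` it follows from the measurable case by
outer regularity, and it frees the users from measurability bookkeeping of crossing events. -/
structure IsRectFlip (S : Set ℤ) (Q : Set (Site 2)) (Φ : Ω → Ω) : Prop where
  measurable : Measurable Φ
  involutive : Function.Involutive Φ
  black_eq : ∀ ω, blackSet S (Φ ω) = symmDiff (blackSet S ω) Q
  anti_eq : ∀ ω, antiSet S (Φ ω) = antiSet S ω
  density_le : ∀ E : Set Ω, μIK (Φ ⁻¹' E) ≤ (16 / 9 : ℝ≥0∞) * μIK E

/-- **S1 — XOR RECTANGLE FLIP QUASI-INVARIANCE (the lever).** For every column pattern `S` and every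
cell rectangle `Q` there is an XOR flip of `Q` in the sense of `IsRectFlip`. Mechanism (triage
F3, re-derived by all three triagers): the plaquette bit of the face at `f` is the parity of the four
colours around it, so `colours ↦ colours ⊕ 1_Q` toggles exactly the ≤ 4 faces meeting `Q` in one
cell; realise it by toggling those faces in BOTH plaquette fields (biased and fair — so the map does
not depend on `S`), XOR-ing the column/row sign sets with the fixed sets forced by the axis values,
and leaving the coins alone; the biased factor has `p = 2√3 − 3`, `(1 − p)/p = 2/√3`. -/
def XorFlip : Prop :=
  ∀ (S : Set ℤ) (Q : Set (Site 2)), IsCellRect Q → ∃ Φ : Ω → Ω, IsRectFlip S Q Φ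

/-- The EXTERIOR σ-algebra of a cell set `Q` (pattern `S`): generated by the colours of the cells
outside `Q` and by the diagonals of the faces — indexed by their lower-left cell — outside `Q`.
(Edges between two cells of a box only read faces whose lower-left cell is in the box, so this is
"everything an exploration that has not entered `Q` can know".) Exterior-measurable events are
invariant under every XOR flip of `Q` (`IsRectFlip.black_eq/anti_eq`), but NOT conversely: the
flip-invariant event "the colouring of `Q` is `σ₀` or its negative" reads the interior, and for
`σ₀` = (left half black, right half white) it kills `bLR` — so the floors below are conditioned on
`exteriorSigma`, never on mere flip-invariance. -/
@[reducible] def exteriorSigma (S : Set ℤ) (Q : Set (Site 2)) : MeasurableSpace Ω :=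
  MeasurableSpace.generateFrom
    ({E | ∃ v, v ∉ Q ∧ E = {ω | v ∈ blackSet S ω}} ∪ {E | ∃ f, f ∉ Q ∧ E = {ω | f ∈ antiSet S ω}})

/-- **S2 — CONDITIONAL BOX DICHOTOMY.** For every `S`, every box with `W, H ≥ 1` and every
EXTERIOR-measurable event `F`: `μ F ≤ μ(bLR ∩ F) + 16/9 · μ(bTB ∩ F)` and
`μ F ≤ μ(bTB ∩ F) + 16/9 · μ(bLR ∩ F)` — under any exterior information the box is crossed by a
black path in at least one direction with conditional probability `≥ 9/25`, uniformly in `S`.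
Proof route: take an XOR flip `Φ` of the box (S1); exterior-measurable events are `Φ`-invariant
(induction on `generateFrom`); Hex lemma for the one-diagonal-per-face triangulation (`bLR ∨ wTB`
and `bTB ∨ wLR` pointwise; tree `cellCrossing_duality_holds` after a translation/encoding
dictionary); `wTB ∩ F = Φ⁻¹(bTB ∩ F)` because a crossing of the box reads only edges inside it;
then `density_le`. Subadditivity of outer measure only — no measurability of crossing events is
needed, and the inequality in fact holds for every `Φ`-invariant `F`. -/
def CondBoxDichotomy : Prop :=
  ∀ (S : Set ℤ) (a b W H : ℤ), 1 ≤ W → 1 ≤ H →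
    ∀ F : Set Ω, MeasurableSet[exteriorSigma S (box a b W H)] F →
      μIK F ≤ μIK (bLR S a b W H ∩ F) + (16 / 9 : ℝ≥0∞) * μIK (bTB S a b W H ∩ F) ∧
      μIK F ≤ μIK (bTB S a b W H ∩ F) + (16 / 9 : ℝ≥0∞) * μIK (bLR S a b W H ∩ F)

/-- **S3 — ISOTROPY FLOOR (the `∀ S` layer).** Squares are crossed by black paths in BOTH directions
with probability `≥ m > 0`, uniformly in the pattern `S`, the side `n ≥ 1` and the position.
Unconditional; a necessary consequence of the crux (aspect ratio 1 instead of 2), and by the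
duality identity `P_S(bLR) + P_S(bTB) = 1` on squares it can only fail through unbounded effective
anisotropy of a columnar mixture of the two (individually self-dual) media. -/
def IsotropyFloor : Prop :=
  ∃ m : ℝ, 0 < m ∧ ∀ (S : Set ℤ) (n : ℕ), 1 ≤ n → ∀ a b : ℤ,
    m ≤ μIK.real (bLR S a b n n) ∧ m ≤ μIK.real (bTB S a b n n)

/-- **Target of S4 / input of S5 — EXTERIOR-UNIFORM SQUARE FLOOR.** Squares are crossed both
ways with conditional probability `≥ m` given ANY exterior-measurable event `F`; equivalently (range-1
Markov property of the plaquette field) the essential infimum over boundary-ring configurations of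
the conditional crossing probabilities is `≥ m`, uniformly in `S`, `n ≥ 1` and the position. With
`F = univ` it is `IsotropyFloor`. -/
def CondSquareFloor : Prop :=
  ∃ m : ℝ, 0 < m ∧ ∀ (S : Set ℤ) (n : ℕ), 1 ≤ n → ∀ (a b : ℤ) (F : Set Ω),
    MeasurableSet[exteriorSigma S (box a b n n)] F →
      m * μIK.real F ≤ μIK.real (bLR S a b n n ∩ F) ∧ m * μIK.real F ≤ μIK.real (bTB S a b n n ∩ F)

/-- The crux over the named gauge (`Negative.iff_named` says this IS `IKMixedBoxCrossing`). -/
def CruxNamed : Prop :=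
  ∃ c : ℝ, 0 < c ∧ ∀ S : Set ℤ, ∀ n : ℕ, 1 ≤ n → ∀ a b : ℤ, c ≤ pH S n a b ∧ c ≤ pV S n a b

/-- `CruxNamed` is the crux, by the disprover's landed unfolding lemma. -/
theorem cruxNamed_iff :
    CruxNamed ↔ Summit.CriticalPhenomena.CardyFormulaZ2.Theses.CardyIKTransport.IKMixedBoxCrossing :=
  iff_named.symm

/-! ## Registered stubs

`stub_*` are the registered obligations (sorried). `Registered.stub_*` are the name-keyed `abbrev`
aliases of their statements, taken as the hypotheses of `IKMixedBoxCrossing_of` (the skeleton audit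
admits a hypothesis whose head's last name component is a declared stub — same device as
`Summits/FinalStateConjecture/FinalStateConjecture/Cruxes/TameCensorship/Lines/necks-are-one-way-valves.lean`). -/

namespace Registered

/-- Alias of `XorFlip` keyed by the registered stub name. -/
abbrev stub_xorFlip : Prop := XorFlip
/-- Alias of `XorFlip → CondBoxDichotomy` keyed by the registered stub name. -/
abbrev stub_condDichotomy : Prop := XorFlip → CondBoxDichotomy
/-- Alias of `IsotropyFloor` keyed by the registered stub name. -/
abbrev stub_isotropyFloor : Prop := IsotropyFloor
/-- Alias of `XorFlip → IsotropyFloor → CondSquareFloor` keyed by the registered stub name. -/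
abbrev stub_boundaryRobustFloor : Prop := XorFlip → IsotropyFloor → CondSquareFloor
/-- Alias of `CondSquareFloor → CondBoxDichotomy → CruxNamed` keyed by the registered stub name. -/
abbrev stub_gluing : Prop := CondSquareFloor → CondBoxDichotomy → CruxNamed

end Registered

/-! ## The composition: the five stubs conclude the crux by name -/

/-- **`IKMixedBoxCrossing` from the five stubs** (real proof, no `sorry`): S2 applied to S1 is the
conditional dichotomy; S4 applied to S1 and S3 is the exterior-uniform square floor; S5 turns the
two into the named crux, which is the crux by `Negative.iff_named`. -/
theorem IKMixedBoxCrossing_of :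
    Registered.stub_xorFlip → Registered.stub_condDichotomy → Registered.stub_isotropyFloor →
      Registered.stub_boundaryRobustFloor → Registered.stub_gluing →
      Summit.CriticalPhenomena.CardyFormulaZ2.Theses.CardyIKTransport.IKMixedBoxCrossing := by
  intro hFlip hDich hFloor hRobust hGlue
  exact iff_named.2 (hGlue (hRobust hFlip hFloor) (hDich hFlip))

/-- The same five stubs conclude the crux decl of the sibling route CardyDiluteOrbit BY NAME (item
stmt-CriticalPhenomena-5911 is shared; the two route decls are textually identical, so the proof is
the previous one up to definitional unfolding). -/
theorem IKMixedBoxCrossing_of_diluteOrbit :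
    Registered.stub_xorFlip → Registered.stub_condDichotomy → Registered.stub_isotropyFloor →
      Registered.stub_boundaryRobustFloor → Registered.stub_gluing →
      Summit.CriticalPhenomena.CardyFormulaZ2.Theses.CardyDiluteOrbit.IKMixedBoxCrossing := by
  intro hFlip hDich hFloor hRobust hGlue
  have h := IKMixedBoxCrossing_of hFlip hDich hFloor hRobust hGlue
  exact h

end Summit.CriticalPhenomena.CardyFormulaZ2.Cruxes.IKMixedBoxCrossing.XorRectangleFlip

end
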